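import Literature.NumberTheory.LFunctions.NoExceptionalZeroUpTo
import HarnessLib

/-!
# A prime-sum criterion certifying "no real zero in `[1 − c/log q, 1]`" for a quadratic
# character (Lu–Zaman–Zhao 2026, Theorem 2.1 and the algorithm (2.2)–(2.5))

Topic `Literature/NumberTheory/LFunctions`; namespace `Literature.NumberTheory.LFunctions`,
sub-namespace `LuZamanZhao2026`. ONE named fact AS PRINTED (`LuZamanZhao2026.theorem21`, the
explicit inequality, D-0014, not discharged), small definitions (the printed Table 1, the prime
sum (2.3), the right-hand side of (2.5)), and THEOREMS: the **soundness of the decision rule of a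
lineage-B certificate** — if the finite prime sum (2.3) exceeds the bound (2.5), then `L(σ, χ) ≠ 0`
on the whole window — and its table form, which turns a full set of row certificates into the
column's criterion `NoExceptionalZeroUpTo Q c` (`NoExceptionalZeroUpTo.lean`).

## What the source prints

R. F. Lu, A. Zaman, H. Zhao, *Numerical computations concerning Landau–Siegel zeros*, Math. Comp.
(2026), doi:10.1090/mcom/4268 = arXiv:2602.03626 (held; pp. 4, 7, 17–18 read):

* **Theorem 2.1.** "Let `χ` be a primitive non-principal character modulo `q`. Assume `L(s, χ)`
  has a real zero at `β₁ ∈ (0, 1)`. Write `σ = 1 + r` for `r > 0`. Then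
  (2.1) `∑_{n=1}^{∞} Λ(n)(1 + ℜ{χ(n)})/n^σ ≤ 1/r − 1/(σ − β₁) + (σ − β₁)/R² + ϕ log q + E`,
  where `R = r + 7/8` and the values `r`, `ϕ`, and `E` are given by Table 1."
  Table 1: `(r, ϕ, E) = (1.6/10 log 10, 0.22675, 1.1614)`, `(1.3/10 log 10, 0.23083, 1.1805)`,
  `(1.2/10 log 10, 0.23222, 1.1870)`, `(1.1/10 log 10, 0.23362, 1.1936)` (§3, p. 7: "we will set
  `r = λ/log(10¹⁰)` for some fixed `λ > 0`"; §6, p. 14: "let `χ` be a primitive character of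
  modulus `q ≥ 3`"; §7: Theorem 2.1 is Corollary 6.4 at these four values of `r`).
* The algorithm (p. 4): by non-negativity, for `S = {p^k : p ≤ N prime, k ≥ 1}`,
  (2.2)–(2.3) `∑_{p ≤ N} (log p/(p^σ − 1) + χ(p) log p/(p^σ − χ(p))) ≤ ∑_n Λ(n)(1 + χ(n))/n^σ`;
  "if additionally `β₁ ≥ 1 − c/log q` … then (2.4) becomes
  (2.5) `∑_{p ≤ N}(…) ≤ c/(r(r log q + c)) + (r + c/log q)/R² + ϕ log q + E`.
  Our algorithm can now be explained in a simple manner: if we verify that (2.5) is false by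
  computing both sides, then this proves `L(σ, χ) ≠ 0` for `σ ≥ 1 − c/log q`."

## Contents

* `LuZamanZhao2026.Table1 lam phi E` (the four printed rows, `r = lam/(10 log 10)`),
  `LuZamanZhao2026.rOf lam = lam/(10 log 10)`.
* `LuZamanZhao2026.theorem21` — **named fact, Theorem 2.1 as printed** (moduli `q ≥ 3`; the series
  rendered as a real `tsum` over `n : ℕ`, the term at `n = 0` being `0`).
* `LuZamanZhao2026.primeSum χ σ N` — the left side of (2.3)/(2.5) (for real-valued `χ`:
  `ℜχ(p)` in place of `χ(p)`); `LuZamanZhao2026.rhs c lam phi E q` — the right side of (2.5).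
* PROVED: `primeSum_le_tsum` ((2.2)–(2.3): the prime-power part of a series of non-negative terms,
  two geometric series per prime), `rhs_mono` (the right side of (2.1) increases with `β₁` on the
  window), and the **decision rule** `lfunction_ne_zero_of_rhs_lt_primeSum`:
  `theorem21 →` (`χ` primitive quadratic mod `q ≥ 3`, a Table-1 row, `c > 0`, `N`, and
  `rhs c lam phi E q < primeSum χ (1 + rOf lam) N`) `→ ∀ σ ∈ (0, 1] ∩ [1 − c/log q, 1], L(σ, χ) ≠ 0`;
  table form `noExceptionalZeroUpTo_of_certificates`: one certificate for every primitive
  quadratic `χ` mod `3 ≤ q ≤ Q` gives `NoExceptionalZeroUpTo Q c`.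

What is NOT here: a discharge of Theorem 2.1 (26 pp. of explicit contour estimates, size L); the
numerical evaluation of `primeSum` and `rhs` (transcendental quantities — the certified
interval-arithmetic layer of the data rung, lineage B); the expression of `χ(p)` through the
Kronecker symbol (`PrimitiveQuadraticCharacterKronecker*.lean`).

## References

* R. F. Lu, A. Zaman, H. Zhao, Math. Comp. (2026), doi:10.1090/mcom/4268 = arXiv:2602.03626,
  Theorem 2.1, Table 1, (2.2)–(2.5), §3, Corollary 6.4, §7. [LuZamanZhao2026]
* H. L. Montgomery, R. C. Vaughan, *Multiplicative Number Theory I*, CUP 2007, §1.2–1.3 (Dirichlet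
  series of `−ζ'/ζ`, Euler products). [MontgomeryVaughan2007]
-/

noncomputable section

open Complex Finset Filter Topology
open scoped ArithmeticFunction.vonMangoldt

namespace Literature.NumberTheory.LFunctions

namespace LuZamanZhao2026

/-! ### The printed constants -/

/-- The parameter `r = λ/(10 log 10) = λ/log(10¹⁰)` of Table 1 (§3: "we will set `r = λ/log(10¹⁰)`
for some fixed `λ > 0`"). [cite: LuZamanZhao2026, Table 1 and §3] -/
def rOf (lam : ℝ) : ℝ := lam / (10 * Real.log 10)

/-- **Table 1 of Lu–Zaman–Zhao** ("Constants in Theorem 2.1"): the four printed rows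
`(r, ϕ, E) = (1.6/10 log 10, 0.22675, 1.1614)`, `(1.3/10 log 10, 0.23083, 1.1805)`,
`(1.2/10 log 10, 0.23222, 1.1870)`, `(1.1/10 log 10, 0.23362, 1.1936)`, indexed here by
`λ ∈ {1.6, 1.3, 1.2, 1.1}` with `r = rOf λ`. [cite: LuZamanZhao2026, Table 1] -/
def Table1 (lam phi E : ℝ) : Prop :=
  (lam = 1.6 ∧ phi = 0.22675 ∧ E = 1.1614) ∨ (lam = 1.3 ∧ phi = 0.23083 ∧ E = 1.1805) ∨
    (lam = 1.2 ∧ phi = 0.23222 ∧ E = 1.1870) ∨ (lam = 1.1 ∧ phi = 0.23362 ∧ E = 1.1936)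

/-- Every `λ` of Table 1 satisfies `1 ≤ λ ≤ 2` (so `0 < r < 1/4`). [cite: LuZamanZhao2026, Table 1] -/
theorem Table1.one_le_and_le_two {lam phi E : ℝ} (h : Table1 lam phi E) : 1 ≤ lam ∧ lam ≤ 2 := by
  rcases h with ⟨rfl, -, -⟩ | ⟨rfl, -, -⟩ | ⟨rfl, -, -⟩ | ⟨rfl, -, -⟩ <;> norm_num

/-- `log 10 > 2` (as `e² < 7.39 < 10`). [folklore] -/
private theorem two_lt_log_ten : 2 < Real.log 10 := by
  rw [Real.lt_log_iff_exp_lt (by norm_num)]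
  have h := Real.exp_one_lt_d9
  have h2 : Real.exp 2 = Real.exp 1 ^ 2 := by rw [← Real.exp_nat_mul]; norm_num
  rw [h2]
  nlinarith [Real.exp_pos 1]

/-- For a Table-1 row, `0 < r = rOf λ` and `r < 1/4` (indeed `r ≤ 2/20 = 1/10`).
[cite: LuZamanZhao2026, Table 1] -/
theorem rOf_pos_of_table1 {lam phi E : ℝ} (h : Table1 lam phi E) : 0 < rOf lam ∧ rOf lam < 1 / 4 := by
  obtain ⟨h1, h2⟩ := h.one_le_and_le_two
  have hlog := two_lt_log_ten
  refine ⟨div_pos (by linarith) (by linarith), ?_⟩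
  rw [rOf, div_lt_iff₀ (by linarith)]
  linarith

/-! ### The named fact -/

/-- **Lu–Zaman–Zhao 2026, Theorem 2.1 (as printed, p. 4): "Let `χ` be a primitive non-principal
character modulo `q`. Assume `L(s, χ)` has a real zero at `β₁ ∈ (0, 1)`. Write `σ = 1 + r` for
`r > 0`. Then `∑_{n=1}^{∞} Λ(n)(1 + ℜ{χ(n)})/n^σ ≤ 1/r − 1/(σ − β₁) + (σ − β₁)/R² + ϕ log q + E`,
where `R = r + 7/8` and the values `r`, `ϕ`, and `E` are given by Table 1."** Rendering: moduli
`q ≥ 3` (§6: "a primitive character of modulus `q ≥ 3`"; primitive characters of such moduli are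
non-principal); `(r, ϕ, E)` ranges over the four rows of `Table1` (`r = rOf λ`); the series is the
real `tsum` over `n : ℕ` (the `n = 0` term vanishes), which converges for `σ > 1`; `L` is Mathlib's
`DirichletCharacter.LFunction` at the real point `β₁`. Proof in print: Corollary 6.4 (an explicit
inequality for `−ζ'/ζ(1 + r) − ℜ L'/L(1 + r, χ)` from a contour of radius `r + 7/8`, Phragmén–Lindelöf
with the explicit convexity bound, 14 pp.) evaluated at the four `r` by certified arithmetic; not
discharged here (size L). [cite: LuZamanZhao2026, Theorem 2.1 and Table 1] -/
def theorem21 : Prop :=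
  ∀ (q : ℕ) [NeZero q], 3 ≤ q → ∀ χ : DirichletCharacter ℂ q, χ.IsPrimitive →
    ∀ β₁ : ℝ, 0 < β₁ → β₁ < 1 → χ.LFunction β₁ = 0 →
      ∀ lam phi E : ℝ, Table1 lam phi E →
        ∑' n : ℕ, (Λ n : ℝ) * (1 + (χ (n : ZMod q)).re) / (n : ℝ) ^ (1 + rOf lam) ≤
          1 / rOf lam - 1 / (1 + rOf lam - β₁) + (1 + rOf lam - β₁) / (rOf lam + 7 / 8) ^ 2 +
            phi * Real.log q + E

/-! ### The two sides of the certificate inequality (2.5) -/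

/-- The prime sum (2.3) truncated at `N`, for a character with real values at primes:
`∑_{p ≤ N} (log p/(p^σ − 1) + χ(p) log p/(p^σ − χ(p)))` (with `ℜχ(p)` for `χ(p)`).
[cite: LuZamanZhao2026, (2.3)] -/
def primeSum {q : ℕ} (χ : DirichletCharacter ℂ q) (σ : ℝ) (N : ℕ) : ℝ :=
  ∑ p ∈ (range (N + 1)).filter Nat.Prime,
    (Real.log p / ((p : ℝ) ^ σ - 1) +
      (χ (p : ZMod q)).re * Real.log p / ((p : ℝ) ^ σ - (χ (p : ZMod q)).re))

/-- The right-hand side of (2.5): `c/(r(r log q + c)) + (r + c/log q)/R² + ϕ log q + E` with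
`r = rOf λ`, `R = r + 7/8`. [cite: LuZamanZhao2026, (2.5)] -/
def rhs (c lam phi E : ℝ) (q : ℕ) : ℝ :=
  c / (rOf lam * (rOf lam * Real.log q + c)) + (rOf lam + c / Real.log q) / (rOf lam + 7 / 8) ^ 2 +
    phi * Real.log q + E

/-! ### (2.2)–(2.3): the prime-power part of the series -/

/-- `∑_n Λ(n) n^{−σ} < ∞` for real `σ > 1` (the Dirichlet series of `−ζ'/ζ`). [folklore] -/
private theorem summable_vonMangoldt_mul_rpow_neg {σ : ℝ} (hσ : 1 < σ) :
    Summable fun n : ℕ ↦ (Λ n : ℝ) * (n : ℝ) ^ (-σ) := by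
  have h := (ArithmeticFunction.LSeriesSummable_vonMangoldt (s := (σ : ℂ)) (by simpa using hσ)).norm
  refine h.congr fun n ↦ ?_
  rcases Nat.eq_zero_or_pos n with rfl | hn
  · simp
  rw [LSeries.term_def₀ (by simp) (σ : ℂ) n, norm_mul, Complex.norm_real, Real.norm_eq_abs,
    abs_of_nonneg ArithmeticFunction.vonMangoldt_nonneg,
    show (-(σ : ℂ)) = ((-σ : ℝ) : ℂ) by push_cast; ring,
    Complex.norm_natCast_cpow_of_pos hn, Complex.ofReal_re]

/-- The general term `Λ(n)(1 + ℜχ(n))/n^σ` of (2.1). [cite: LuZamanZhao2026, (2.1)] -/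
private def term {q : ℕ} (χ : DirichletCharacter ℂ q) (σ : ℝ) (n : ℕ) : ℝ :=
  (Λ n : ℝ) * (1 + (χ (n : ZMod q)).re) / (n : ℝ) ^ σ

/-- `1 + ℜχ(n) ≥ 0` since `|χ(n)| ≤ 1`. [folklore] -/
private theorem one_add_re_nonneg {q : ℕ} (χ : DirichletCharacter ℂ q) (a : ZMod q) :
    0 ≤ 1 + (χ a).re := by
  have h1 : |(χ a).re| ≤ 1 := (Complex.abs_re_le_norm _).trans (DirichletCharacter.norm_le_one χ a)
  have := (abs_le.1 h1).1
  linarith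

/-- The terms of (2.1) are non-negative. [cite: LuZamanZhao2026, (2.2)] -/
private theorem term_nonneg {q : ℕ} (χ : DirichletCharacter ℂ q) (σ : ℝ) (n : ℕ) : 0 ≤ term χ σ n :=
  div_nonneg (mul_nonneg ArithmeticFunction.vonMangoldt_nonneg (one_add_re_nonneg χ _))
    (Real.rpow_nonneg (Nat.cast_nonneg n) σ)

/-- The series (2.1) converges for `σ > 1` (comparison with `2 ∑ Λ(n) n^{−σ}`). [folklore] -/
private theorem summable_term {q : ℕ} (χ : DirichletCharacter ℂ q) {σ : ℝ} (hσ : 1 < σ) :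
    Summable (term χ σ) := by
  refine Summable.of_nonneg_of_le (term_nonneg χ σ)
    (fun n ↦ ?_) ((summable_vonMangoldt_mul_rpow_neg hσ).mul_left 2)
  -- `term n ≤ 2 Λ(n) n^{-σ}`
  have hre : (χ (n : ZMod q)).re ≤ 1 :=
    (le_abs_self _).trans ((Complex.abs_re_le_norm _).trans (DirichletCharacter.norm_le_one χ _))
  have hΛ : 0 ≤ (Λ n : ℝ) := ArithmeticFunction.vonMangoldt_nonneg
  have hnσ : 0 ≤ (n : ℝ) ^ σ := Real.rpow_nonneg (Nat.cast_nonneg n) σ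
  unfold term
  rw [Real.rpow_neg (Nat.cast_nonneg n), div_eq_mul_inv]
  calc (Λ n : ℝ) * (1 + (χ (n : ZMod q)).re) * ((n : ℝ) ^ σ)⁻¹
      ≤ (Λ n : ℝ) * 2 * ((n : ℝ) ^ σ)⁻¹ := by
        refine mul_le_mul_of_nonneg_right (mul_le_mul_of_nonneg_left (by linarith) hΛ) ?_
        exact inv_nonneg.2 hnσ
    _ = 2 * ((Λ n : ℝ) * ((n : ℝ) ^ σ)⁻¹) := by ring

/-- A quadratic character takes a REAL value `t ∈ {0, 1, −1}` at every point. [folklore] -/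
private theorem exists_real_eq_of_isQuadratic {q : ℕ} {χ : DirichletCharacter ℂ q}
    (hquad : χ.IsQuadratic) (a : ZMod q) :
    ∃ t : ℝ, χ a = (t : ℂ) ∧ |t| ≤ 1 := by
  rcases hquad a with h | h | h
  · exact ⟨0, by simp [h], by simp⟩
  · exact ⟨1, by simp [h], by simp⟩
  · exact ⟨-1, by simp [h], by simp⟩

/-- Distinct pairs `(p, k)` (`p` prime) give distinct prime powers `p^{k+1}`. [folklore] -/
private theorem primePow_injOn (P : Finset ℕ) (hP : ∀ p ∈ P, p.Prime) (K : ℕ) :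
    Set.InjOn (fun x : ℕ × ℕ ↦ x.1 ^ (x.2 + 1)) ↑(P ×ˢ range K) := by
  rintro ⟨p₁, k₁⟩ h₁ ⟨p₂, k₂⟩ h₂ heq
  simp only [coe_product, Set.mem_prod, mem_coe] at h₁ h₂
  have hp₁ := hP _ h₁.1
  have hp₂ := hP _ h₂.1
  simp only at heq
  have hdvd : p₁ ∣ p₂ ^ (k₂ + 1) := heq ▸ dvd_pow_self p₁ (Nat.succ_ne_zero k₁)
  have hpp : p₁ = p₂ := (Nat.prime_dvd_prime_iff_eq hp₁ hp₂).1 (hp₁.dvd_of_dvd_pow hdvd)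
  subst hpp
  have hk : k₁ + 1 = k₂ + 1 := Nat.pow_right_injective hp₁.two_le heq
  simp only [Prod.mk.injEq, true_and]
  omega

/-- **The term of (2.1) at a prime power.** For `χ` quadratic with `χ(p) = t` (`t` real) and
`σ > 0`: `Λ(p^{k+1})(1 + ℜχ(p^{k+1}))/(p^{k+1})^σ = log p · ((p^{−σ})^{k+1} + (t p^{−σ})^{k+1})`.
[cite: LuZamanZhao2026, (2.3)] -/
private theorem term_primePow {q : ℕ} (χ : DirichletCharacter ℂ q) (σ : ℝ) {p : ℕ} (hp : p.Prime)
    {t : ℝ} (ht : χ (p : ZMod q) = (t : ℂ)) (k : ℕ) :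
    term χ σ (p ^ (k + 1)) =
      Real.log p * ((((p : ℝ) ^ σ)⁻¹) ^ (k + 1) + (t * ((p : ℝ) ^ σ)⁻¹) ^ (k + 1)) := by
  have hp0 : (0 : ℝ) ≤ p := Nat.cast_nonneg p
  have hΛ : (Λ (p ^ (k + 1)) : ℝ) = Real.log p := by
    rw [ArithmeticFunction.vonMangoldt_apply_pow (Nat.succ_ne_zero k),
      ArithmeticFunction.vonMangoldt_apply_prime hp]
  have hχ : (χ ((p ^ (k + 1) : ℕ) : ZMod q)).re = t ^ (k + 1) := by
    rw [Nat.cast_pow, map_pow, ht, ← Complex.ofReal_pow, Complex.ofReal_re]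
  have hpow : ((p ^ (k + 1) : ℕ) : ℝ) ^ σ = ((p : ℝ) ^ σ) ^ (k + 1) := by
    rw [Nat.cast_pow, ← Real.rpow_natCast, ← Real.rpow_mul hp0, mul_comm, Real.rpow_mul hp0,
      Real.rpow_natCast]
  unfold term
  rw [hΛ, hχ, hpow, mul_pow, inv_pow]
  field_simp

/-- **The geometric series at one prime** ((2.3)): for `p` prime, `σ > 0` with `p^σ > 1`, and `χ`
quadratic with `χ(p) = t`: `∑_{k ≥ 1} Λ(p^k)(1 + ℜχ(p^k))/p^{kσ} = log p/(p^σ − 1) + t log p/(p^σ − t)`.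
[cite: LuZamanZhao2026, (2.3)] -/
private theorem hasSum_term_primePow {q : ℕ} (χ : DirichletCharacter ℂ q) {σ : ℝ} (hσ : 0 < σ)
    {p : ℕ} (hp : p.Prime) {t : ℝ} (ht : χ (p : ZMod q) = (t : ℂ)) (ht1 : |t| ≤ 1) :
    HasSum (fun k : ℕ ↦ term χ σ (p ^ (k + 1)))
      (Real.log p / ((p : ℝ) ^ σ - 1) + t * Real.log p / ((p : ℝ) ^ σ - t)) := by
  set P : ℝ := (p : ℝ) ^ σ with hP
  have hp1 : (1 : ℝ) < p := by exact_mod_cast hp.one_lt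
  have hP1 : 1 < P := Real.one_lt_rpow hp1 hσ
  have hP0 : 0 < P := by linarith
  set x : ℝ := P⁻¹ with hx
  have hx0 : 0 < x := inv_pos.2 hP0
  have hx1 : x < 1 := inv_lt_one_of_one_lt₀ hP1
  have htx : |t * x| < 1 := by
    rw [abs_mul, abs_of_pos hx0]
    calc |t| * x ≤ 1 * x := mul_le_mul_of_nonneg_right ht1 hx0.le
      _ = x := one_mul x
      _ < 1 := hx1
  -- the two geometric series `∑_{k ≥ 0} y^{k+1} = y (1 - y)⁻¹`
  have h1 : HasSum (fun k : ℕ ↦ x ^ (k + 1)) (x * (1 - x)⁻¹) := by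
    have := (hasSum_geometric_of_lt_one hx0.le hx1).mul_left x
    simpa [pow_succ'] using this
  have h2 : HasSum (fun k : ℕ ↦ (t * x) ^ (k + 1)) ((t * x) * (1 - t * x)⁻¹) := by
    have := (hasSum_geometric_of_abs_lt_one htx).mul_left (t * x)
    simpa [pow_succ'] using this
  have h := (h1.add h2).mul_left (Real.log p)
  have hfun : (fun k : ℕ ↦ term χ σ (p ^ (k + 1))) =
      fun k : ℕ ↦ Real.log p * (x ^ (k + 1) + (t * x) ^ (k + 1)) := by
    funext k
    rw [term_primePow χ σ hp ht k]
  -- the values agree: `x/(1-x) = 1/(P-1)`, `tx/(1-tx) = t/(P-t)`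
  have hPx : P - 1 ≠ 0 := by linarith
  have hPt : P - t ≠ 0 := by
    have := (abs_le.1 ht1).2
    intro h0; linarith
  have h1x : 1 - x ≠ 0 := by linarith
  have htx1 : 1 - t * x ≠ 0 := by
    have := (abs_lt.1 htx).2
    intro h0; linarith
  have hval : Real.log p * (x * (1 - x)⁻¹ + t * x * (1 - t * x)⁻¹) =
      Real.log p / (P - 1) + t * Real.log p / (P - t) := by
    rw [hx]
    field_simp
  rw [hfun, ← hval]
  exact h

/-- **(2.2)–(2.3): the prime sum is at most the full series.** For `χ` quadratic mod `q`, `σ > 1`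
and every `N`: `primeSum χ σ N ≤ ∑_n Λ(n)(1 + ℜχ(n))/n^σ` (the series restricted to the prime
powers `p^k`, `p ≤ N`, a subfamily of non-negative terms, summed prime by prime as two geometric
series). [cite: LuZamanZhao2026, (2.2) and (2.3)] -/
theorem primeSum_le_tsum {q : ℕ} (χ : DirichletCharacter ℂ q) (hquad : χ.IsQuadratic) {σ : ℝ}
    (hσ : 1 < σ) (N : ℕ) :
    primeSum χ σ N ≤ ∑' n : ℕ, (Λ n : ℝ) * (1 + (χ (n : ZMod q)).re) / (n : ℝ) ^ σ := by
  change primeSum χ σ N ≤ ∑' n : ℕ, term χ σ n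
  set P : Finset ℕ := (range (N + 1)).filter Nat.Prime with hPdef
  have hP : ∀ p ∈ P, p.Prime := fun p hp ↦ (mem_filter.1 hp).2
  have hsum := summable_term χ hσ
  -- partial sums over `k < K` of the prime-power terms are bounded by the series
  have hle : ∀ K : ℕ, ∑ p ∈ P, ∑ k ∈ range K, term χ σ (p ^ (k + 1)) ≤ ∑' n : ℕ, term χ σ n := by
    intro K
    rw [← sum_product (s := P) (t := range K) (f := fun x : ℕ × ℕ ↦ term χ σ (x.1 ^ (x.2 + 1))),
      ← sum_image (primePow_injOn P hP K)]
    exact hsum.sum_le_tsum _ (fun n _ ↦ term_nonneg χ σ n)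
  -- and they converge to `primeSum`
  have hlim : Tendsto (fun K : ℕ ↦ ∑ p ∈ P, ∑ k ∈ range K, term χ σ (p ^ (k + 1))) atTop
      (𝓝 (primeSum χ σ N)) := by
    unfold primeSum
    rw [← hPdef]
    refine tendsto_finsetSum P fun p hp ↦ ?_
    obtain ⟨t, ht, ht1⟩ := exists_real_eq_of_isQuadratic hquad (p : ZMod q)
    have h := (hasSum_term_primePow χ (σ := σ) (by linarith) (hP p hp) ht ht1).tendsto_sum_nat
    have hre : (χ (p : ZMod q)).re = t := by rw [ht, Complex.ofReal_re]
    rw [hre]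
    exact h
  exact le_of_tendsto' hlim hle

/-! ### The right-hand side of (2.1) on the window -/

/-- **Monotonicity of the right side of (2.1) in `β₁`.** For `r > 0`, `log q > 0`, `c > 0` and
`1 − c/log q ≤ β₁ < 1`: `1/r − 1/(1 + r − β₁) + (1 + r − β₁)/R² ≤ c/(r(r log q + c)) + (r + c/log q)/R²`
(`δ = 1 + r − β₁ ∈ (r, r + c/log q]`, `−1/δ + δ/R²` increases with `δ`, and
`1/r − 1/(r + c/log q) = c/(r(r log q + c))`) — the passage from (2.4) to (2.5).
[cite: LuZamanZhao2026, (2.4)–(2.5)] -/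
theorem rhs_mono {r c L R β₁ : ℝ} (hr : 0 < r) (hL : 0 < L) (hc : 0 < c) (hR : 0 < R)
    (hβ : 1 - c / L ≤ β₁) (hβ1 : β₁ < 1) :
    1 / r - 1 / (1 + r - β₁) + (1 + r - β₁) / R ^ 2 ≤
      c / (r * (r * L + c)) + (r + c / L) / R ^ 2 := by
  set δ : ℝ := 1 + r - β₁ with hδ
  have hδr : r < δ := by rw [hδ]; linarith
  have hδ0 : 0 < δ := hr.trans hδr
  have hδ1 : δ ≤ r + c / L := by rw [hδ]; linarith
  have hcL : 0 < c / L := div_pos hc hL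
  have h1 : 1 / (r + c / L) ≤ 1 / δ := one_div_le_one_div_of_le hδ0 hδ1
  have h2 : δ / R ^ 2 ≤ (r + c / L) / R ^ 2 := div_le_div_of_nonneg_right hδ1 (by positivity)
  have h3 : 1 / r - 1 / (r + c / L) = c / (r * (r * L + c)) := by
    field_simp
    ring
  linarith

/-! ### The decision rule -/

/-- **Soundness of the certificate (the algorithm of §2.1).** Assume Theorem 2.1. Let `χ` be a
primitive quadratic character mod `q ≥ 3`, `(λ, ϕ, E)` a row of Table 1 (`r = λ/(10 log 10)`,
`σ₁ = 1 + r`), `c > 0` and `N` such that the certificate inequality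
`c/(r(r log q + c)) + (r + c/log q)/R² + ϕ log q + E < ∑_{p ≤ N}(log p/(p^{σ₁} − 1) + χ(p) log p/(p^{σ₁} − χ(p)))`
holds, i.e. (2.5) FAILS. Then `L(σ, χ) ≠ 0` for every real `σ` with `0 < σ ≤ 1` and
`σ ≥ 1 − c/log q`. (A zero `β₁ = σ < 1` would give, by Theorem 2.1, (2.2)–(2.3) and the
monotonicity in `β₁`, exactly (2.5); at `σ = 1`, `L(1, χ) ≠ 0`.)
[cite: LuZamanZhao2026, Theorem 2.1 and (2.2)–(2.5)] -/
theorem lfunction_ne_zero_of_rhs_lt_primeSum (h21 : theorem21) {q : ℕ} [NeZero q] (hq : 3 ≤ q)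
    {χ : DirichletCharacter ℂ q} (hprim : χ.IsPrimitive) (hquad : χ.IsQuadratic)
    {lam phi E : ℝ} (hrow : Table1 lam phi E) {c : ℝ} (hc : 0 < c) {N : ℕ}
    (hcert : rhs c lam phi E q < primeSum χ (1 + rOf lam) N)
    {σ : ℝ} (hσ0 : 0 < σ) (hσ : 1 - c / Real.log q ≤ σ) (hσ1 : σ ≤ 1) : χ.LFunction σ ≠ 0 := by
  intro hzero
  have hne : χ ≠ 1 := SiegelZeroQuality.ne_one_of_isPrimitive hprim (by omega)
  rcases eq_or_lt_of_le hσ1 with rfl | hlt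
  · exact DirichletCharacter.LFunction_ne_zero_of_one_le_re χ (Or.inl hne) (by simp) hzero
  have hr := (rOf_pos_of_table1 hrow).1
  have hq3 : (3 : ℝ) ≤ (q : ℝ) := by exact_mod_cast hq
  have hlogq : 0 < Real.log q := Real.log_pos (by linarith)
  -- Theorem 2.1 at `β₁ = σ`, then (2.2)–(2.3) and the monotonicity: this is (2.5)
  have h1 := h21 q hq χ hprim σ hσ0 hlt hzero lam phi E hrow
  have h2 := primeSum_le_tsum χ hquad (σ := 1 + rOf lam) (by linarith) N
  have h3 := rhs_mono (R := rOf lam + 7 / 8) hr hlogq hc (by linarith) hσ hlt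
  have : primeSum χ (1 + rOf lam) N ≤ rhs c lam phi E q := by
    unfold rhs
    linarith
  linarith

/-- **Table form: a full set of certificates is a no-exceptional-zero table.** Assume Theorem 2.1
and `c > 0`. If for every modulus `3 ≤ q ≤ Q` and every primitive quadratic `χ` mod `q` some row
`(λ, ϕ, E)` of Table 1 and some `N` satisfy the certificate inequality
`rhs c λ ϕ E q < primeSum χ (1 + rOf λ) N`, then `NoExceptionalZeroUpTo Q c`: no such `L(s, χ)`
vanishes on `[1 − c/log q, 1] ∩ (0, 1]`. (Lu–Zaman–Zhao's run: `Q = 10¹⁰`, `c = 1/5`, for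
`q > 4·10⁵`.) [cite: LuZamanZhao2026, Theorem 2.1 and §2.1–§3] -/
theorem noExceptionalZeroUpTo_of_certificates (h21 : theorem21) {Q : ℕ} {c : ℝ} (hc : 0 < c)
    (hcert : ∀ (q : ℕ) [NeZero q], 3 ≤ q → q ≤ Q → ∀ χ : DirichletCharacter ℂ q,
      χ.IsQuadratic → χ.IsPrimitive →
        ∃ lam phi E : ℝ, Table1 lam phi E ∧ ∃ N : ℕ, rhs c lam phi E q < primeSum χ (1 + rOf lam) N) :
    NoExceptionalZeroUpTo Q c := by
  intro q _ hq3 hqQ χ hquad hprim σ hσ0 hσ hσ1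
  obtain ⟨lam, phi, E, hrow, N, hN⟩ := hcert q hq3 hqQ χ hquad hprim
  exact lfunction_ne_zero_of_rhs_lt_primeSum h21 hq3 hprim hquad hrow hc hN hσ0 hσ hσ1

/-- **Mixed tables.** Certificates for the moduli `Q₀ < q ≤ Q` on top of a table
`NoExceptionalZeroUpTo Q₀ c` (e.g. Platt's range `Q₀ = 4·10⁵` at any `c ≤ 1/2`, file
`NoExceptionalZeroUpTo.lean`) give `NoExceptionalZeroUpTo Q c` — the shape of Lu–Zaman–Zhao's
proof of their Theorem 1.1 (§3: "For `q ≤ 4×10⁵`, we apply Platt's result. For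
`4×10⁵ < q ≤ 10¹⁰` …"). [cite: LuZamanZhao2026, §3] -/
theorem noExceptionalZeroUpTo_of_certificates_above (h21 : theorem21) {Q₀ Q : ℕ} {c : ℝ}
    (hc : 0 < c) (h₀ : NoExceptionalZeroUpTo Q₀ c)
    (hcert : ∀ (q : ℕ) [NeZero q], Q₀ < q → q ≤ Q → ∀ χ : DirichletCharacter ℂ q,
      χ.IsQuadratic → χ.IsPrimitive →
        ∃ lam phi E : ℝ, Table1 lam phi E ∧ ∃ N : ℕ, rhs c lam phi E q < primeSum χ (1 + rOf lam) N) :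
    NoExceptionalZeroUpTo Q c := by
  intro q _ hq3 hqQ χ hquad hprim σ hσ0 hσ hσ1
  by_cases hq₀ : q ≤ Q₀
  · exact h₀ q hq3 hq₀ χ hquad hprim σ hσ0 hσ hσ1
  · obtain ⟨lam, phi, E, hrow, N, hN⟩ := hcert q (lt_of_not_ge hq₀) hqQ χ hquad hprim
    exact lfunction_ne_zero_of_rhs_lt_primeSum h21 hq3 hprim hquad hrow hc hN hσ0 hσ hσ1

end LuZamanZhao2026

end Literature.NumberTheory.LFunctions

end
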